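import Summits.PneNP.PneNP.Theorems.ExpanderLinearGeneratorsResolutionNFreeLaw
import HarnessLib

/-!
# The n-free resolution-size rung for expanding linear systems, V: short refutations use many rows

Support file for crux `stmt-PneNP-11442` (`ExpansionForcesDepthFregeSize`). The STRUCTURAL form of
the n-free law of files I–IV: the overload term of the master inequality is charged to any set `U`
of rows containing the rows whose clauses the refutation downloads (`one_le_card_mul_add`:
`1 ≤ |U| · 2^ℓ/(K+1)^{L+1} + |π| · ((2K+1)/(2K+2))^{W/2+1}`), so that a refutation confined to FEW
rows is EXPONENTIALLY long (`exp_le_length_of_few_rows`): for `r ≥ 2`, if the downloaded rows lie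
in a set of at most `r^{(1-ε)⌈3ℓ/4⌉} / 2^{ℓ+1}` rows then `|π| ≥ exp(r^ε/64) / 2`. Equivalently:
every resolution refutation of the XOR-CNF of an `ℓ`-sparse `(r, 3ℓ/4)`-boundary expander of
length `< exp(r^ε/64)/2` downloads clauses of more than `r^{(1-ε)⌈3ℓ/4⌉}/2^{ℓ+1}` distinct rows —
short refutations of expanders are necessarily spread over `r^{Ω(ℓ)}` rows (any `n`, any `m`).

References: P. Beame, T. Pitassi, FOCS 1996; E. Ben-Sasson, A. Wigderson, J. ACM 48 (2001), §3,
Thm. 6.5; J. Krajíček, *Proof complexity* (CUP 2019), §13.4, Problem 19.4.5.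
-/

namespace Summit.PneNP.PneNP.Theorems.ResNFree

set_option linter.dupNamespace false -- `Summit.PneNP.PneNP.…`: summit = sub-problem (D-0017)

open Finset Filter Topology Literature.Computability.Complexity Literature.Computability.MetaComplexity
open Summit.PneNP.PneNP.Theorems.ResKRestriction

variable {m n : ℕ}

/-- **The master inequality, charged to the downloaded rows.** Let the row supports of `E` have
size `≤ ℓ` and form an `(r, c)`-boundary expander, `r ≥ 2`, and let every initial line of the
resolution refutation `π` of `sumEncoding 1 E` download a clause of a row in `U`. Then for every
`L < c`, `W < (c - L) r / 2` and `K`,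
`1 ≤ |U| · 2^ℓ/(K+1)^{L+1} + |π| · ((2K+1)/(2K+2))^{W/2+1}`.
[Beame–Pitassi 1996; Ben-Sasson–Wigderson 2001, §3, Thm. 6.5] [folklore] -/
theorem one_le_card_mul_add (E : Fin m → LinEqMod 2 n) {r c : ℝ}
    (hexp : IsBoundaryExpander (rowVars E) r c) (hr : 2 ≤ r) {ℓ L W : ℕ} (K : ℕ)
    (hsparse : ∀ i, (E i).supp.card ≤ ℓ) (hcL : (L : ℝ) < c)
    (hW : (W : ℝ) < (c - L) * r / 2) {π : List (ResLine ℕ)}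
    (hπ : IsResRefutation (sumEncoding 1 E) π) {U : Finset (Fin m)}
    (hU : ∀ l ∈ π, l.rule = ResRule.initial →
      ∃ k ∈ U, ∃ cl ∈ equationCNF 1 (E k), cl.toFinset = l.clause) :
    (1 : ℝ) ≤ U.card * ((2 : ℝ) ^ ℓ / ((K : ℝ) + 1) ^ (L + 1)) +
      π.length * ((2 * (K : ℝ) + 1) / (2 * K + 2)) ^ (W / 2 + 1) := by
  classical
  -- the sample space, its restrictions and assigned sets
  set ρ : (Fin n → Fin (K + 1)) × (Fin n → Bool) → ℕ → Option Bool := fun ω v =>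
    if h : v < n then (if ω.1 ⟨v, h⟩ = 0 then some (ω.2 ⟨v, h⟩) else none) else some false
    with hρ
  set Aset : (Fin n → Fin (K + 1)) × (Fin n → Bool) → Finset ℕ := fun ω =>
    (univ.filter fun j : Fin n => ω.1 j = 0).map Fin.valEmbedding with hAset
  -- every sample is bad
  have hbad : ∀ ω : (Fin n → Fin (K + 1)) × (Fin n → Bool),
      (∃ k ∈ U, L + 1 ≤ ((rowVars E k) ∩ Aset ω).card) ∨
      (∃ l ∈ π, ¬ SatisfiedBy (ρ ω) l.clause ∧ W < (restrictClause (ρ ω) l.clause).card) := by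
    intro ω
    by_contra h
    push Not at h
    obtain ⟨h1, h2⟩ := h
    have hload : ∀ k ∈ U, ((rowVars E k) ∩ Aset ω).card ≤ L :=
      fun k hk => Nat.lt_succ_iff.1 (h1 k hk)
    have hρA : ∀ v, v < n → v ∉ Aset ω → ρ ω v = none := by
      intro v hv hvA
      simp only [hρ, hv, ↓reduceDIte]
      split_ifs with h0
      · refine absurd ?_ hvA
        simp only [hAset]
        exact Finset.mem_map.2 ⟨⟨v, hv⟩, Finset.mem_filter.2 ⟨Finset.mem_univ _, h0⟩, rfl⟩
      · rfl
    obtain ⟨l, hl, hns, hwide⟩ :=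
      exists_unsatisfied_wide_line E hexp hr hcL hW hπ hU hload (ρ ω) hρA
    exact absurd hwide (not_lt.2 (h2 l hl hns))
  -- the bad sets
  set B₁ : Fin m → Finset ((Fin n → Fin (K + 1)) × (Fin n → Bool)) := fun k =>
    univ.filter fun ω => L + 1 ≤ ((rowVars E k) ∩ Aset ω).card with hB₁
  set B₂ : ResLine ℕ → Finset ((Fin n → Fin (K + 1)) × (Fin n → Bool)) := fun l =>
    univ.filter fun ω => ¬ SatisfiedBy (ρ ω) l.clause ∧ W < (restrictClause (ρ ω) l.clause).card
    with hB₂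
  have hcover : (univ : Finset ((Fin n → Fin (K + 1)) × (Fin n → Bool)))
      ⊆ U.biUnion B₁ ∪ π.toFinset.biUnion B₂ := by
    intro ω _
    rcases hbad ω with ⟨k, hk, hkω⟩ | ⟨l, hl, hlω⟩
    · refine Finset.mem_union_left _ (Finset.mem_biUnion.2 ⟨k, hk, ?_⟩)
      simp only [hB₁, Finset.mem_filter, Finset.mem_univ, true_and]
      exact hkω
    · refine Finset.mem_union_right _ (Finset.mem_biUnion.2 ⟨l, List.mem_toFinset.2 hl, ?_⟩)
      simp only [hB₂, Finset.mem_filter, Finset.mem_univ, true_and]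
      exact hlω
  -- sizes
  set N : ℕ := (K + 1) ^ n * 2 ^ n with hN
  have hcardΩ : Fintype.card ((Fin n → Fin (K + 1)) × (Fin n → Bool)) = N := card_sample n K
  have hNpos : (0 : ℝ) < N := by rw [hN]; positivity
  have hKpos : (0 : ℝ) < ((K : ℝ) + 1) ^ (L + 1) := by positivity
  have hB₁card : ∀ k, ((B₁ k).card : ℝ) ≤ (2 : ℝ) ^ ℓ / ((K : ℝ) + 1) ^ (L + 1) * N := by
    intro k
    have h := card_overload_le (K := K) (L := L) ((E k).supp) (hsparse k) (B₁ k) fun ω hω => by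
      have hω' := (Finset.mem_filter.1 hω).2
      exact hω'.trans (card_rowVars_inter_le E k ω.1)
    rw [div_mul_eq_mul_div, le_div_iff₀ hKpos]
    exact h
  have hB₂card : ∀ l : ResLine ℕ,
      ((B₂ l).card : ℝ) ≤ ((2 * (K : ℝ) + 1) / (2 * K + 2)) ^ (W / 2 + 1) * N := by
    intro l
    exact card_survive_le (K := K) (W := W) l.clause (B₂ l) fun ω hω => (Finset.mem_filter.1 hω).2
  have htot : (N : ℝ) ≤ U.card * ((2 : ℝ) ^ ℓ / ((K : ℝ) + 1) ^ (L + 1) * N) +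
      π.toFinset.card * (((2 * (K : ℝ) + 1) / (2 * K + 2)) ^ (W / 2 + 1) * N) := by
    have h1 : N ≤ ∑ k ∈ U, (B₁ k).card + ∑ l ∈ π.toFinset, (B₂ l).card :=
      calc N = (univ : Finset ((Fin n → Fin (K + 1)) × (Fin n → Bool))).card := by
            rw [Finset.card_univ, hcardΩ]
        _ ≤ (U.biUnion B₁ ∪ π.toFinset.biUnion B₂).card := Finset.card_le_card hcover
        _ ≤ (U.biUnion B₁).card + (π.toFinset.biUnion B₂).card := Finset.card_union_le _ _
        _ ≤ ∑ k ∈ U, (B₁ k).card + ∑ l ∈ π.toFinset, (B₂ l).card :=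
            Nat.add_le_add Finset.card_biUnion_le Finset.card_biUnion_le
    have h1' : (N : ℝ) ≤ ∑ k ∈ U, ((B₁ k).card : ℝ) + ∑ l ∈ π.toFinset, ((B₂ l).card : ℝ) := by
      exact_mod_cast h1
    refine h1'.trans (add_le_add ?_ ?_)
    · calc ∑ k ∈ U, ((B₁ k).card : ℝ)
          ≤ ∑ k ∈ U, (2 : ℝ) ^ ℓ / ((K : ℝ) + 1) ^ (L + 1) * N := Finset.sum_le_sum fun k _ => hB₁card k
        _ = U.card * ((2 : ℝ) ^ ℓ / ((K : ℝ) + 1) ^ (L + 1) * N) := by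
            rw [Finset.sum_const, nsmul_eq_mul]
    · calc ∑ l ∈ π.toFinset, ((B₂ l).card : ℝ)
          ≤ ∑ l ∈ π.toFinset, ((2 * (K : ℝ) + 1) / (2 * K + 2)) ^ (W / 2 + 1) * N :=
            Finset.sum_le_sum fun l _ => hB₂card l
        _ = π.toFinset.card * (((2 * (K : ℝ) + 1) / (2 * K + 2)) ^ (W / 2 + 1) * N) := by
            rw [Finset.sum_const, nsmul_eq_mul]
  -- divide by `N`
  have hπ' : (π.toFinset.card : ℝ) ≤ π.length := by exact_mod_cast List.toFinset_card_le π
  have h2 : (N : ℝ) ≤ (U.card * ((2 : ℝ) ^ ℓ / ((K : ℝ) + 1) ^ (L + 1)) +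
      π.length * ((2 * (K : ℝ) + 1) / (2 * K + 2)) ^ (W / 2 + 1)) * N := by
    calc (N : ℝ) ≤ U.card * ((2 : ℝ) ^ ℓ / ((K : ℝ) + 1) ^ (L + 1) * N) +
          π.toFinset.card * (((2 * (K : ℝ) + 1) / (2 * K + 2)) ^ (W / 2 + 1) * N) := htot
      _ ≤ U.card * ((2 : ℝ) ^ ℓ / ((K : ℝ) + 1) ^ (L + 1) * N) +
          π.length * (((2 * (K : ℝ) + 1) / (2 * K + 2)) ^ (W / 2 + 1) * N) :=
          add_le_add le_rfl (mul_le_mul_of_nonneg_right hπ' (by positivity))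
      _ = (U.card * ((2 : ℝ) ^ ℓ / ((K : ℝ) + 1) ^ (L + 1)) +
          π.length * ((2 * (K : ℝ) + 1) / (2 * K + 2)) ^ (W / 2 + 1)) * N := by ring
  by_contra hlt
  push Not at hlt
  have : (U.card * ((2 : ℝ) ^ ℓ / ((K : ℝ) + 1) ^ (L + 1)) +
      π.length * ((2 * (K : ℝ) + 1) / (2 * K + 2)) ^ (W / 2 + 1)) * N < 1 * N :=
    mul_lt_mul_of_pos_right hlt hNpos
  linarith

/-- **Short refutations of expanders use many rows (n-free).** For `ℓ ≥ 1`, `0 < ε < 1` and every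
real `r ≥ 2`: if the row supports of the `ℓ`-sparse system `E : Fin m → LinEqMod 2 n` form an
`(r, 3ℓ/4)`-boundary expander and a resolution refutation `π` of `sumEncoding 1 E` downloads only
clauses of rows in a set `U` with `|U| ≤ r^{(1-ε)⌈3ℓ/4⌉} / 2^{ℓ+1}`, then `|π| ≥ exp(r^ε/64) / 2`.
[Beame–Pitassi 1996; Ben-Sasson–Wigderson 2001, Thm. 6.5] [folklore] -/
theorem exp_le_length_of_few_rows (ℓ : ℕ) (hℓ : 1 ≤ ℓ) (ε : ℝ) (hε : 0 < ε) (hε1 : ε < 1)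
    {r : ℝ} (hr2 : 2 ≤ r) {n m : ℕ} (E : Fin m → LinEqMod 2 n) (hsparse : ∀ i, (E i).supp.card ≤ ℓ)
    (hexp : IsBoundaryExpander (fun i => (E i).supp.map Fin.valEmbedding) r (3 / 4 * ℓ))
    {π : List (ResLine ℕ)} (hπ : IsResRefutation (sumEncoding 1 E) π) {U : Finset (Fin m)}
    (hU : ∀ l ∈ π, l.rule = ResRule.initial →
      ∃ k ∈ U, ∃ cl ∈ equationCNF 1 (E k), cl.toFinset = l.clause)
    (hUcard : (U.card : ℝ) ≤ r ^ ((1 - ε) * ⌈(3 : ℝ) / 4 * ℓ⌉₊) / 2 ^ (ℓ + 1)) :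
    Real.exp (r ^ ε / 64) / 2 ≤ (π.length : ℝ) := by
  -- the constants `c = 3ℓ/4`, `T = ⌈c⌉`, `L = T - 1`
  set c : ℝ := 3 / 4 * ℓ with hc
  have hℓ' : (1 : ℝ) ≤ ℓ := by exact_mod_cast hℓ
  have hcpos : 0 < c := by rw [hc]; positivity
  set T : ℕ := ⌈c⌉₊ with hT
  have hT1 : 1 ≤ T := Nat.one_le_iff_ne_zero.2 (Nat.ceil_pos.2 hcpos).ne'
  set L : ℕ := T - 1 with hL
  have hLT : L + 1 = T := Nat.sub_add_cancel hT1
  have hLreal : (L : ℝ) = T - 1 := by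
    have : ((L + 1 : ℕ) : ℝ) = T := by exact_mod_cast hLT
    push_cast at this
    linarith
  have hLc : (L : ℝ) < c := by
    have h1 : (T : ℝ) < c + 1 := Nat.ceil_lt_add_one hcpos.le
    linarith
  have hcL4 : (1 : ℝ) / 4 ≤ c - L := by
    have hz : (0 : ℝ) < ((3 * (ℓ : ℤ) - 4 * (T : ℤ) + 4 : ℤ) : ℝ) := by
      push_cast
      rw [hc] at hLc
      linarith
    have hz' : (0 : ℤ) < 3 * (ℓ : ℤ) - 4 * (T : ℤ) + 4 := by exact_mod_cast hz
    have hz1 : (1 : ℤ) ≤ 3 * (ℓ : ℤ) - 4 * (T : ℤ) + 4 := hz'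
    have hz1' : ((1 : ℤ) : ℝ) ≤ ((3 * (ℓ : ℤ) - 4 * (T : ℤ) + 4 : ℤ) : ℝ) := by exact_mod_cast hz1
    push_cast at hz1'
    rw [hc, hLreal]
    linarith
  have hr0 : 0 < r := by linarith
  -- the width threshold `W`
  set x : ℝ := (c - L) * r / 2 with hx
  have hxge : r / 8 ≤ x := by rw [hx]; nlinarith
  have hxpos : 0 < x := by linarith
  set W : ℕ := ⌈x⌉₊ - 1 with hWdef
  have hW1 : 1 ≤ ⌈x⌉₊ := Nat.one_le_iff_ne_zero.2 (Nat.ceil_pos.2 hxpos).ne'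
  have hWreal : (W : ℝ) = ⌈x⌉₊ - 1 := by
    have : ((W + 1 : ℕ) : ℝ) = ⌈x⌉₊ := by rw [hWdef]; exact_mod_cast Nat.sub_add_cancel hW1
    push_cast at this
    linarith
  have hWx : (W : ℝ) < x := by
    have h1 : (⌈x⌉₊ : ℝ) < x + 1 := Nat.ceil_lt_add_one hxpos.le
    linarith
  have hWge : x - 1 ≤ W := by
    have h1 : x ≤ (⌈x⌉₊ : ℝ) := Nat.le_ceil x
    linarith
  -- the sampling rate
  set K : ℕ := ⌈r ^ (1 - ε)⌉₊ - 1 with hKdef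
  have hrpow : 0 < r ^ (1 - ε) := Real.rpow_pos_of_pos hr0 _
  have hK1 : 1 ≤ ⌈r ^ (1 - ε)⌉₊ := Nat.one_le_iff_ne_zero.2 (Nat.ceil_pos.2 hrpow).ne'
  have hKeq : (K : ℝ) + 1 = ⌈r ^ (1 - ε)⌉₊ := by
    have : ((K + 1 : ℕ) : ℝ) = ⌈r ^ (1 - ε)⌉₊ := by
      rw [hKdef]; exact_mod_cast Nat.sub_add_cancel hK1
    push_cast at this
    exact this
  have hKge : r ^ (1 - ε) ≤ (K : ℝ) + 1 := by rw [hKeq]; exact Nat.le_ceil _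
  have hKle : (K : ℝ) + 1 ≤ r ^ (1 - ε) + 1 := by
    rw [hKeq]; exact (Nat.ceil_lt_add_one hrpow.le).le
  -- the charged master inequality
  have hM := one_le_card_mul_add E hexp hr2 K hsparse hLc (by rw [← hx]; exact hWx) hπ hU
  -- the first term is at most `1/2`
  have hra : 0 < r ^ ((1 - ε) * T) := Real.rpow_pos_of_pos hr0 _
  have ht1 : (U.card : ℝ) * ((2 : ℝ) ^ ℓ / ((K : ℝ) + 1) ^ (L + 1)) ≤ 1 / 2 := by
    have h1 : (2 : ℝ) ^ ℓ / ((K : ℝ) + 1) ^ (L + 1) ≤ 2 ^ ℓ / r ^ ((1 - ε) * T) := by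
      rw [hLT]
      refine div_le_div_of_nonneg_left (by positivity) hra ?_
      calc r ^ ((1 - ε) * T) = (r ^ (1 - ε)) ^ (T : ℕ) := by
            rw [Real.rpow_mul hr0.le, Real.rpow_natCast]
        _ ≤ ((K : ℝ) + 1) ^ T := pow_le_pow_left₀ hrpow.le hKge T
    calc (U.card : ℝ) * ((2 : ℝ) ^ ℓ / ((K : ℝ) + 1) ^ (L + 1))
        ≤ (r ^ ((1 - ε) * T) / 2 ^ (ℓ + 1)) * (2 ^ ℓ / r ^ ((1 - ε) * T)) :=
          mul_le_mul hUcard h1 (by positivity) (by positivity)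
      _ = 1 / 2 := by
          field_simp
          ring
  -- the second term is at most `exp(-r^ε/64)`
  have ht2 : ((2 * (K : ℝ) + 1) / (2 * K + 2)) ^ (W / 2 + 1) ≤ Real.exp (-(r ^ ε) / 64) := by
    have hK0 : (0 : ℝ) < 2 * (K : ℝ) + 2 := by positivity
    have hbase : (2 * (K : ℝ) + 1) / (2 * K + 2) = -(1 / (2 * K + 2)) + 1 := by
      field_simp; ring
    have hbase_le : (2 * (K : ℝ) + 1) / (2 * K + 2) ≤ Real.exp (-(1 / (2 * K + 2))) := by
      rw [hbase]; exact Real.add_one_le_exp _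
    have hbase0 : (0 : ℝ) ≤ (2 * (K : ℝ) + 1) / (2 * K + 2) := by positivity
    have hq : r / 16 ≤ ((W / 2 + 1 : ℕ) : ℝ) := by
      have hdm := Nat.div_add_mod W 2
      have hmod : W % 2 ≤ 1 := Nat.lt_succ_iff.1 (Nat.mod_lt _ (by norm_num))
      have h1 : ((2 * (W / 2) + W % 2 : ℕ) : ℝ) = W := by exact_mod_cast hdm
      have h2 : ((W % 2 : ℕ) : ℝ) ≤ 1 := by exact_mod_cast hmod
      push_cast at h1 ⊢
      linarith
    have hstep1 : ((2 * (K : ℝ) + 1) / (2 * K + 2)) ^ (W / 2 + 1)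
        ≤ Real.exp (-(1 / (2 * K + 2))) ^ (W / 2 + 1) := pow_le_pow_left₀ hbase0 hbase_le _
    have hstep2 : Real.exp (-(1 / (2 * (K : ℝ) + 2))) ^ (W / 2 + 1)
        = Real.exp (((W / 2 + 1 : ℕ) : ℝ) * -(1 / (2 * K + 2))) := by
      rw [Real.exp_nat_mul]
    have hstep3 : Real.exp (((W / 2 + 1 : ℕ) : ℝ) * -(1 / (2 * (K : ℝ) + 2)))
        ≤ Real.exp (-(r ^ ε) / 64) := by
      rw [Real.exp_le_exp]
      have h2K : 2 * (K : ℝ) + 2 ≤ 4 * r ^ (1 - ε) := by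
        have : (1 : ℝ) ≤ r ^ (1 - ε) := Real.one_le_rpow (by linarith) (by linarith)
        linarith
      have hprod : r ^ ε * r ^ (1 - ε) = r := by
        rw [← Real.rpow_add hr0]; norm_num
      have hrε : 0 ≤ r ^ ε := (Real.rpow_pos_of_pos hr0 _).le
      have hq' : r ^ ε / 64 ≤ ((W / 2 + 1 : ℕ) : ℝ) / (2 * K + 2) := by
        rw [div_le_div_iff₀ (by norm_num) hK0]
        calc r ^ ε * (2 * (K : ℝ) + 2) ≤ r ^ ε * (4 * r ^ (1 - ε)) :=
              mul_le_mul_of_nonneg_left h2K hrε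
          _ = 4 * r := by rw [mul_left_comm, hprod]
          _ ≤ ((W / 2 + 1 : ℕ) : ℝ) * 64 := by linarith
      have : ((W / 2 + 1 : ℕ) : ℝ) * -(1 / (2 * (K : ℝ) + 2))
          = -(((W / 2 + 1 : ℕ) : ℝ) / (2 * K + 2)) := by ring
      rw [this, neg_div]
      exact neg_le_neg hq'
    calc ((2 * (K : ℝ) + 1) / (2 * K + 2)) ^ (W / 2 + 1)
        ≤ Real.exp (-(1 / (2 * K + 2))) ^ (W / 2 + 1) := hstep1
      _ = Real.exp (((W / 2 + 1 : ℕ) : ℝ) * -(1 / (2 * K + 2))) := hstep2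
      _ ≤ Real.exp (-(r ^ ε) / 64) := hstep3
  -- conclusion: `1/2 ≤ |π| exp(-r^ε/64)`
  have hhalf : (1 : ℝ) / 2 ≤ π.length * Real.exp (-(r ^ ε) / 64) := by
    have := mul_le_mul_of_nonneg_left ht2 (Nat.cast_nonneg π.length)
    linarith
  have hinv : Real.exp (r ^ ε / 64) * Real.exp (-(r ^ ε) / 64) = 1 := by
    rw [← Real.exp_add]
    have : r ^ ε / 64 + -(r ^ ε) / 64 = 0 := by ring
    rw [this, Real.exp_zero]
  rw [div_le_iff₀ (by norm_num : (0 : ℝ) < 2)]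
  calc Real.exp (r ^ ε / 64) = Real.exp (r ^ ε / 64) * 1 := (mul_one _).symm
    _ ≤ Real.exp (r ^ ε / 64) * (2 * (π.length * Real.exp (-(r ^ ε) / 64))) :=
        mul_le_mul_of_nonneg_left (by linarith) (Real.exp_pos _).le
    _ = π.length * 2 * (Real.exp (r ^ ε / 64) * Real.exp (-(r ^ ε) / 64)) := by ring
    _ = (π.length : ℝ) * 2 := by rw [hinv, mul_one]

end Summit.PneNP.PneNP.Theorems.ResNFree
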